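import Mathlib.LinearAlgebra.Lagrange
import Mathlib.Analysis.Complex.CauchyIntegral
import Literature.Analysis.Complex.BranchedCoveringCharPoly
import HarnessLib

/-!
# Coefficients of the Lagrange interpolation polynomial: Hankel identity, partial fractions, and a contour formula

Layer `Literature/Analysis/Complex`. For a finite set `R ⊂ ℂ` of `d` distinct nodes with nodal polynomial
`Π(X) = ∏_{r ∈ R} (X - r) = Σ_m π_m X^m` (Mathlib's `Lagrange.nodal R id`) and values `g : ℂ → ℂ`, the coefficients
`a_j = [X^j] L_g`, `L_g = Lagrange.interpolate R id g` (the polynomial of degree `< d` with `L_g(r) = g(r)`), satisfy: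

* `coeff_nodal_erase_eq_sum` — **synthetic division**: `[X^j] (Π/(X - r)) = Σ_{i < d - j} π_{j+1+i} r^i` for `r ∈ R`;
* `coeff_interpolate_eq_sum` — `a_j = Σ_{r ∈ R} g(r) · w_r · [X^j](Π/(X - r))` with the nodal weights
  `w_r = ∏_{r' ≠ r} (r - r')⁻¹`;
* `sum_powerSum_mul_coeff_interpolate` — the **Hankel (normal) equations** `Σ_j (Σ_r r^{l+j}) a_j = Σ_r r^l g(r)`
  (the Vandermonde system `Σ_j a_j r^j = g(r)` multiplied by its transpose);
* `sum_nodalWeight_mul_div_eq` — **partial fractions**: for `s ∉ R`,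
  `Σ_r w_r [X^j](Π/(X - r)) / (s - r) = (Σ_{i < d-j} π_{j+1+i} s^i) / Π(s)` (Lagrange interpolation of the polynomial
  `Σ_i π_{j+1+i} X^i` of degree `< d`, first barycentric form);
* `circleIntegral_mul_kernel_eq` — **contour formula**: if `G` is holomorphic on a closed disc `D̄` whose boundary circle
  avoids `R`, then `∮_{∂D} G(s) (Σ_i π_{j+1+i} s^i)/Π(s) ds = 2πi Σ_{r ∈ R ∩ D} G(r) w_r [X^j](Π/(X - r))` — the part of
  `a_j` carried by the nodes inside `D`, for any holomorphic `G` interpolating `g` there (Cauchy's integral formula termwise);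
* `norm_kernel_le` — the kernel `(Σ_i π_{j+1+i} s^i)/Π(s)` is bounded by `d (1 + ρ_R)^d (1 + |s|)^d / ρ^d` when all nodes
  lie in the disc `|r| ≤ ρ_R` and at distance `≥ ρ` from `s`.

These are the one-variable facts behind the boundedness of the interpolation coefficients of a holomorphic function
along a branched covering near a branch point (Serre, GAGA n° 19–20, algebraisation of holomorphic functions of
polynomial growth; used in `AffineHypersurfaceFibreInterpolation`). Everything is proved; no definitions, no named facts.

## References

* J.-P. Serre, *Géométrie algébrique et géométrie analytique*, Ann. Inst. Fourier 6 (1956), n° 19–20. [SerreGAGA1956]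
* J.-P. Berrut, L. N. Trefethen, Barycentric Lagrange interpolation, SIAM Rev. 46 (2004), §2–§3 (Lagrange's formula,
  nodal weights, first barycentric form). [BerrutTrefethen2004]
* D. Gaier, *Lectures on Complex Approximation* (1987), Ch. II §1 (Hermite's interpolation formula). [Gaier1987]
-/

noncomputable section

open Polynomial Lagrange Finset Complex MeasureTheory Metric
open scoped Real

namespace Literature.Analysis.Complex

namespace LagrangeContour

variable (R : Finset ℂ)

/-! ### Synthetic division: the coefficients of `Π/(X - r)` -/

/-- **Synthetic division.** For a node `r ∈ R` and any `N` with `#R ≤ j + N`: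
`[X^j] (Π/(X - r)) = Σ_{i < N} π_{j+1+i} r^i`, where `Π = nodal R id = (X - r) · nodal (R.erase r) id`
(compare coefficients in `Π = (X - r) Q` and telescope; the synthetic-division step behind the first barycentric
form). [cite: BerrutTrefethen2004, §3 eq. (3.1)–(3.3)] -/
theorem coeff_nodal_erase_eq_sum {r : ℂ} (hr : r ∈ R) (j N : ℕ) (hN : R.card ≤ j + N) :
    (nodal (R.erase r) id).coeff j = ∑ i ∈ range N, (nodal R id).coeff (j + 1 + i) * r ^ i := by
  classical
  set Q := nodal (R.erase r) id with hQ
  have hnod : nodal R id = (X - C r) * Q := by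
    rw [hQ]; exact nodal_eq_mul_nodal_erase (v := id) hr
  have hcoeff : ∀ n, (nodal R id).coeff (n + 1) = Q.coeff n - r * Q.coeff (n + 1) := by
    intro n; rw [hnod, coeff_X_sub_C_mul]
  have hQdeg : Q.natDegree = R.card - 1 := by
    rw [hQ, natDegree_nodal, card_erase_of_mem hr]
  have hQN : Q.coeff (j + N) = 0 := by
    apply coeff_eq_zero_of_natDegree_lt
    rw [hQdeg]
    have : 0 < R.card := card_pos.mpr ⟨r, hr⟩
    omega
  have htel : ∑ i ∈ range N, (nodal R id).coeff (j + 1 + i) * r ^ i =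
      ∑ i ∈ range N, (Q.coeff (j + i) * r ^ i - Q.coeff (j + (i + 1)) * r ^ (i + 1)) := by
    refine sum_congr rfl fun i _ ↦ ?_
    rw [show j + 1 + i = (j + i) + 1 by ring, hcoeff, sub_mul, pow_succ]
    ring_nf
  rw [htel, Finset.sum_range_sub' (fun i ↦ Q.coeff (j + i) * r ^ i), add_zero, pow_zero, mul_one, hQN,
    zero_mul, sub_zero]

/-! ### The interpolation coefficients -/

/-- **The coefficients of the Lagrange interpolant**: `[X^j] L_g = Σ_{r ∈ R} g(r) · (w_r · [X^j](Π/(X - r)))`, with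
`w_r = nodalWeight R id r` (Lagrange's formula with the weights of the first barycentric form).
[cite: BerrutTrefethen2004, §3 eq. (3.1)–(3.3)] -/
theorem coeff_interpolate_eq_sum (g : ℂ → ℂ) (j : ℕ) :
    (interpolate R id g).coeff j =
      ∑ r ∈ R, g r * (nodalWeight R id r * (nodal (R.erase r) id).coeff j) := by
  classical
  rw [interpolate_eq_nodalWeight_mul_nodal_div_X_sub_C, finsetSum_coeff]
  refine sum_congr rfl fun r hr ↦ ?_
  rw [← nodal_erase_eq_nodal_div hr, coeff_mul_C, coeff_C_mul]
  ring

/-- **The interpolant takes the prescribed values**, coefficientwise: `Σ_{j < d} [X^j] L_g · r^j = g(r)` for `r ∈ R`,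
`d = #R`. [cite: BerrutTrefethen2004, §2 eq. (2.1)–(2.4)] -/
theorem sum_coeff_interpolate_mul_pow {r : ℂ} (hr : r ∈ R) (g : ℂ → ℂ) :
    ∑ j ∈ range R.card, (interpolate R id g).coeff j * r ^ j = g r := by
  have hinj : Set.InjOn (id : ℂ → ℂ) R := Set.injOn_id _
  have hdeg : (interpolate R id g).natDegree < R.card := by
    rcases eq_or_ne (interpolate R id g) 0 with h0 | h0
    · rw [h0, natDegree_zero]; exact card_pos.mpr ⟨r, hr⟩
    · have := degree_interpolate_lt g hinj
      rwa [degree_eq_natDegree h0, Nat.cast_lt] at this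
  have := eval_interpolate_at_node g hinj hr
  rw [eval_eq_sum_range' hdeg] at this
  simpa only [id] using this

/-- **The Hankel (normal) equations of Lagrange interpolation**: `Σ_{j < d} (Σ_{r ∈ R} r^{l+j}) · [X^j] L_g
= Σ_{r ∈ R} r^l g(r)` — the Vandermonde system `V a = g` multiplied by `Vᵀ` (`(VᵀV)_{lj} = Σ_r r^{l+j}`); a restatement of the interpolation conditions. [cite: BerrutTrefethen2004, §2 eq. (2.1)–(2.4)] -/
theorem sum_powerSum_mul_coeff_interpolate (g : ℂ → ℂ) (l : ℕ) :
    ∑ j ∈ range R.card, (∑ r ∈ R, r ^ (l + j)) * (interpolate R id g).coeff j =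
      ∑ r ∈ R, r ^ l * g r := by
  calc ∑ j ∈ range R.card, (∑ r ∈ R, r ^ (l + j)) * (interpolate R id g).coeff j
      = ∑ r ∈ R, r ^ l * ∑ j ∈ range R.card, (interpolate R id g).coeff j * r ^ j := by
        simp only [sum_mul, mul_sum, pow_add]
        rw [sum_comm]
        refine sum_congr rfl fun r _ ↦ sum_congr rfl fun j _ ↦ by ring
    _ = ∑ r ∈ R, r ^ l * g r := sum_congr rfl fun r hr ↦ by rw [sum_coeff_interpolate_mul_pow R hr]

/-! ### Partial fractions for the kernel -/

/-- **Partial fractions.** For `s ∉ R`: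
`Σ_{r ∈ R} w_r [X^j](Π/(X - r)) (s - r)⁻¹ = (Σ_{i < d - j} π_{j+1+i} s^i) / Π(s)`: the polynomial
`Λ_j = Σ_{i < d-j} π_{j+1+i} X^i` has degree `< d` and value `[X^j](Π/(X - r))` at the node `r` (synthetic division),
so it is its own Lagrange interpolant, whose first barycentric form is `Π(s) Σ_r w_r Λ_j(r) (s - r)⁻¹`.
[cite: BerrutTrefethen2004, §3 eq. (3.3) (first form of the barycentric formula)] -/
theorem sum_nodalWeight_mul_div_eq (j : ℕ) {s : ℂ} (hs : s ∉ R) :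
    ∑ r ∈ R, nodalWeight R id r * (nodal (R.erase r) id).coeff j * (s - r)⁻¹ =
      (∑ i ∈ range (R.card - j), (nodal R id).coeff (j + 1 + i) * s ^ i) / (nodal R id).eval s := by
  classical
  have hinj : Set.InjOn (id : ℂ → ℂ) R := Set.injOn_id _
  set Λ : ℂ[X] := ∑ i ∈ range (R.card - j), C ((nodal R id).coeff (j + 1 + i)) * X ^ i with hΛ
  have hΛeval : ∀ x, Λ.eval x = ∑ i ∈ range (R.card - j), (nodal R id).coeff (j + 1 + i) * x ^ i := by
    intro x; simp only [hΛ, eval_finsetSum, eval_mul, eval_C, eval_pow, eval_X]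
  have hΛnode : ∀ r ∈ R, Λ.eval (id r) = (nodal (R.erase r) id).coeff j := by
    intro r hr
    rw [id, hΛeval, coeff_nodal_erase_eq_sum R hr j (R.card - j) (by omega)]
  have hΛdeg : Λ.degree < R.card := by
    rw [hΛ]
    refine (degree_sum_le _ _).trans_lt ?_
    rw [Finset.sup_lt_iff (WithBot.bot_lt_coe _)]
    intro i hi
    refine (degree_C_mul_X_pow_le _ _).trans_lt ?_
    rw [Finset.mem_range] at hi
    exact_mod_cast (by omega : i < R.card)
  have hint : Λ = interpolate R id fun r ↦ (nodal (R.erase r) id).coeff j :=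
    eq_interpolate_of_eval_eq (r := fun r ↦ (nodal (R.erase r) id).coeff j) hinj hΛdeg hΛnode
  have hne : (nodal R id).eval s ≠ 0 := eval_nodal_not_at_node (v := id) (fun r hr h ↦ hs (by rw [h]; exact hr))
  rw [← hΛeval s, hint, eval_interpolate_not_at_node _ (fun r hr h ↦ hs (by rw [h]; exact hr)), mul_div_cancel_left₀ _ hne]
  simp only [id]
  refine sum_congr rfl fun r _ ↦ by ring


/-! ### The contour formula -/

/-- **Contour formula for the interpolation coefficients carried by a disc.** Let `G` be holomorphic on the closed disc
`|z - c| ≤ ρ'` (`ρ' > 0`) whose boundary circle contains no node. Then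
`∮_{|z-c|=ρ'} G(z) · (Σ_{i < d-j} π_{j+1+i} z^i)/Π(z) dz = 2πi · Σ_{r ∈ R, |r - c| < ρ'} G(r) · w_r · [X^j](Π/(X - r))`:
partial fractions on the circle, then Cauchy's integral formula for the nodes inside and Cauchy's theorem for the nodes
outside the closed disc. When `G` interpolates `g` at the nodes inside, the right side is the part of `[X^j] L_g` they
carry (`coeff_interpolate_eq_sum`). This is Hermite's contour-integral formula for the interpolation polynomial,
`L(z) = (2πi)⁻¹ ∮ (Π(t) - Π(z))/((t - z) Π(t)) G(t) dt`, read coefficientwise and for the nodes inside one disc.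
[cite: Gaier1987, Ch. II §1 (Hermite's interpolation formula)] -/
theorem circleIntegral_mul_kernel_eq (j : ℕ) {c : ℂ} {ρ' : ℝ} (hρ' : 0 < ρ') {G : ℂ → ℂ}
    (hG : DifferentiableOn ℂ G (closedBall c ρ')) (hR : ∀ r ∈ R, r ∉ sphere c ρ') :
    (∮ z in C(c, ρ'), G z * ((∑ i ∈ range (R.card - j), (nodal R id).coeff (j + 1 + i) * z ^ i) /
        (nodal R id).eval z)) =
      2 * π * I * ∑ r ∈ R with dist r c < ρ', G r * (nodalWeight R id r * (nodal (R.erase r) id).coeff j) := by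
  classical
  -- partial fractions on the circle
  have hcong : Set.EqOn
      (fun z ↦ G z * ((∑ i ∈ range (R.card - j), (nodal R id).coeff (j + 1 + i) * z ^ i) / (nodal R id).eval z))
      (fun z ↦ ∑ r ∈ R, (nodalWeight R id r * (nodal (R.erase r) id).coeff j) • ((z - r)⁻¹ • G z))
      (sphere c ρ') := by
    intro z hz
    have hzR : z ∉ R := fun h ↦ hR z h hz
    simp only [smul_eq_mul]
    rw [← sum_nodalWeight_mul_div_eq R j hzR, mul_sum]
    exact sum_congr rfl fun r _ ↦ by ring
  rw [circleIntegral.integral_congr hρ'.le hcong]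
  -- integrate termwise
  have hGc : ContinuousOn G (sphere c ρ') := hG.continuousOn.mono sphere_subset_closedBall
  have hint : ∀ r ∈ R, CircleIntegrable (fun z ↦ (nodalWeight R id r * (nodal (R.erase r) id).coeff j) •
      ((z - r)⁻¹ • G z)) c ρ' := by
    intro r hr
    have h1 : ContinuousOn (fun z : ℂ ↦ (z - r)⁻¹) (sphere c ρ') := by
      refine ContinuousOn.inv₀ (continuousOn_id.sub continuousOn_const) fun z hz h ↦ hR r hr ?_
      have : z = r := sub_eq_zero.mp h
      exact this ▸ hz
    have h2 : ContinuousOn (fun z : ℂ ↦ (nodalWeight R id r * (nodal (R.erase r) id).coeff j) •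
        ((z - r)⁻¹ • G z)) (sphere c ρ') := by
      have h3 := (h1.smul hGc).const_smul (nodalWeight R id r * (nodal (R.erase r) id).coeff j)
      simpa only [Pi.smul_def, Pi.smul_def'] using h3
    exact ContinuousOn.circleIntegrable hρ'.le h2
  rw [circleIntegral.integral_fun_sum hint]
  -- each term: Cauchy's formula inside, Cauchy's theorem outside
  have hterm : ∀ r ∈ R, (∮ z in C(c, ρ'), (nodalWeight R id r * (nodal (R.erase r) id).coeff j) •
      ((z - r)⁻¹ • G z)) = if r ∈ ball c ρ' then
        2 * π * I * (G r * (nodalWeight R id r * (nodal (R.erase r) id).coeff j)) else 0 := by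
    intro r hr
    rw [circleIntegral.integral_smul]
    split_ifs with hrin
    · rw [hG.circleIntegral_sub_inv_smul hrin, smul_eq_mul, smul_eq_mul]; ring
    · have hrout : r ∉ closedBall c ρ' := by
        intro h
        rcases (mem_closedBall.mp h).lt_or_eq with h' | h'
        · exact hrin h'
        · exact hR r hr (mem_sphere.mpr h')
      rw [circleIntegral_eq_zero_of_differentiable_on_off_countable hρ'.le Set.countable_empty, smul_zero]
      · refine ContinuousOn.smul ((continuousOn_id.sub continuousOn_const).inv₀ fun z hz h ↦ ?_) hG.continuousOn
        have : z = r := sub_eq_zero.mp h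
        exact hrout (this ▸ hz)
      · intro z hz
        replace hz : z ∈ ball c ρ' := hz.1
        have hzr : z - r ≠ 0 := fun h ↦ hrout ((sub_eq_zero.mp h) ▸ ball_subset_closedBall hz)
        have hGz : DifferentiableAt ℂ G z :=
          (hG.mono ball_subset_closedBall).differentiableAt (isOpen_ball.mem_nhds hz)
        exact ((differentiableAt_id.sub_const r).inv hzr).smul hGz
  rw [sum_congr rfl hterm, ← sum_filter, mul_sum]
  exact sum_congr (by ext r; simp [mem_ball]) fun _ _ ↦ rfl

/-! ### The size of the kernel away from the nodes -/

/-- **Lower bound for the nodal polynomial away from the nodes**: if every node is at distance `≥ ρ` from `z` then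
`|Π(z)| ≥ ρ^d` (the denominator estimate in Hermite's formula). [cite: Gaier1987, Ch. II §1 (Hermite's interpolation formula)] -/
theorem pow_le_norm_eval_nodal {z : ℂ} {ρ : ℝ} (hρ : 0 ≤ ρ) (h : ∀ r ∈ R, ρ ≤ ‖z - r‖) :
    ρ ^ R.card ≤ ‖(nodal R id).eval z‖ := by
  rw [eval_nodal, norm_prod, ← prod_const]
  exact prod_le_prod (fun _ _ ↦ hρ) fun r hr ↦ h r hr

/-- **The numerator of the kernel is bounded on bounded sets**: if all nodes satisfy `|r| ≤ ρ_R` then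
`|Σ_{i < d-j} π_{j+1+i} z^i| ≤ d (1 + ρ_R)^d (max 1 |z|)^d` (the coefficients of `Π` are bounded by
`∏ (1 + |r|)`; the numerator estimate in Hermite's formula). [cite: Gaier1987, Ch. II §1 (Hermite's interpolation formula)] -/
theorem norm_kernelNumerator_le (j : ℕ) {ρR : ℝ} (hρR : 0 ≤ ρR) (hRle : ∀ r ∈ R, ‖r‖ ≤ ρR) (z : ℂ) :
    ‖∑ i ∈ range (R.card - j), (nodal R id).coeff (j + 1 + i) * z ^ i‖ ≤
      R.card * ((1 + ρR) ^ R.card * (max 1 ‖z‖) ^ R.card) := by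
  have hcoeff : ∀ k, ‖(nodal R id).coeff k‖ ≤ (1 + ρR) ^ R.card := by
    intro k
    rw [nodal_eq]
    refine (BranchedCovering.norm_coeff_prod_X_sub_C_le R id k).trans ?_
    rw [← prod_const]
    exact prod_le_prod (fun _ _ ↦ by positivity) fun r hr ↦ by simpa using hRle r hr
  calc ‖∑ i ∈ range (R.card - j), (nodal R id).coeff (j + 1 + i) * z ^ i‖
      ≤ ∑ i ∈ range (R.card - j), ‖(nodal R id).coeff (j + 1 + i) * z ^ i‖ := norm_sum_le _ _
    _ ≤ ∑ i ∈ range (R.card - j), (1 + ρR) ^ R.card * (max 1 ‖z‖) ^ R.card := by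
        refine sum_le_sum fun i hi ↦ ?_
        rw [norm_mul, norm_pow]
        refine mul_le_mul (hcoeff _) ?_ (by positivity) (by positivity)
        have hi' : i ≤ R.card := by have := Finset.mem_range.mp hi; omega
        calc ‖z‖ ^ i ≤ (max 1 ‖z‖) ^ i := pow_le_pow_left₀ (norm_nonneg _) (le_max_right _ _) _
          _ ≤ (max 1 ‖z‖) ^ R.card := pow_le_pow_right₀ (le_max_left _ _) hi'
    _ = (R.card - j : ℕ) * ((1 + ρR) ^ R.card * (max 1 ‖z‖) ^ R.card) := by rw [sum_const, card_range, nsmul_eq_mul]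
    _ ≤ R.card * ((1 + ρR) ^ R.card * (max 1 ‖z‖) ^ R.card) := by
        gcongr
        exact Nat.sub_le _ _

/-- **The kernel is bounded away from the nodes**: with all nodes in `|r| ≤ ρ_R` and at distance `≥ ρ > 0` from `z`,
`|(Σ_{i<d-j} π_{j+1+i} z^i)/Π(z)| ≤ d (1 + ρ_R)^d (max 1 |z|)^d / ρ^d` (the kernel estimate in Hermite's formula).
[cite: Gaier1987, Ch. II §1 (Hermite's interpolation formula)] -/
theorem norm_kernel_le (j : ℕ) {ρR ρ : ℝ} (hρR : 0 ≤ ρR) (hρ : 0 < ρ) (hRle : ∀ r ∈ R, ‖r‖ ≤ ρR) {z : ℂ}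
    (hfar : ∀ r ∈ R, ρ ≤ ‖z - r‖) :
    ‖(∑ i ∈ range (R.card - j), (nodal R id).coeff (j + 1 + i) * z ^ i) / (nodal R id).eval z‖ ≤
      R.card * ((1 + ρR) ^ R.card * (max 1 ‖z‖) ^ R.card) / ρ ^ R.card := by
  rw [norm_div]
  have hden : ρ ^ R.card ≤ ‖(nodal R id).eval z‖ := pow_le_norm_eval_nodal R hρ.le hfar
  have hpos : 0 < ρ ^ R.card := pow_pos hρ _
  calc _ ≤ ‖∑ i ∈ range (R.card - j), (nodal R id).coeff (j + 1 + i) * z ^ i‖ / ρ ^ R.card :=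
        div_le_div_of_nonneg_left (norm_nonneg _) hpos hden
    _ ≤ _ := div_le_div_of_nonneg_right (norm_kernelNumerator_le R j hρR hRle z) hpos.le

/-- **Size of a contour term**: if `|G| ≤ M` and the kernel is bounded by `K` on the circle `|z - c| = ρ'`, then
`|(2πi)⁻¹ ∮ G · kernel| ≤ ρ' M K` (the standard estimate of Hermite's integral).
[cite: Gaier1987, Ch. II §1 (Hermite's interpolation formula)] -/
theorem norm_inv_two_pi_I_mul_circleIntegral_le {c : ℂ} {ρ' : ℝ} (hρ' : 0 < ρ') {G κ : ℂ → ℂ} {M K : ℝ}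
    (hM0 : 0 ≤ M) (hM : ∀ z ∈ sphere c ρ', ‖G z‖ ≤ M) (hK : ∀ z ∈ sphere c ρ', ‖κ z‖ ≤ K) :
    ‖(2 * π * I)⁻¹ * ∮ z in C(c, ρ'), G z * κ z‖ ≤ ρ' * (M * K) := by
  have hint : ‖∮ z in C(c, ρ'), G z * κ z‖ ≤ 2 * π * |ρ'| * (M * K) := by
    refine circleIntegral.norm_integral_le_of_norm_le_const' fun z hz ↦ ?_
    rw [abs_of_pos hρ'] at hz
    rw [norm_mul]
    exact mul_le_mul (hM z hz) (hK z hz) (norm_nonneg _) hM0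
  rw [norm_mul, norm_inv, norm_mul, norm_mul, Complex.norm_I, mul_one, Complex.norm_ofNat, Complex.norm_real,
    Real.norm_eq_abs, abs_of_pos Real.pi_pos, abs_of_pos hρ'] at *
  calc (2 * π)⁻¹ * ‖∮ z in C(c, ρ'), G z * κ z‖ ≤ (2 * π)⁻¹ * (2 * π * ρ' * (M * K)) :=
        mul_le_mul_of_nonneg_left hint (by positivity)
    _ = ρ' * (M * K) := by field_simp

end LagrangeContour

end Literature.Analysis.Complex
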